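import Summits.BirchSwinnertonDyer.BirchSwinnertonDyer.Theorems.SignedLowerHalvesKobayashiMainConjectureSmallImageParityStratumExact
import Summits.BirchSwinnertonDyer.Rank1Residual.Supersingular.KobayashiMainConjectureX7FouquetWan
import Summits.BirchSwinnertonDyer.Rank1Residual.Supersingular.KobayashiMainConjectureX7
import Summits.BirchSwinnertonDyer.BirchSwinnertonDyer.Theorems.SignedLowerHalvesKobayashiLowerHalfLargeImagePairedDescent
import Summits.BirchSwinnertonDyer.Rank1Residual.X1.LambdaSqueezeAlgebra
import Literature.NumberTheory.EllipticCurves.CyclotomicIwasawaMainTheoremIrreducibleProofs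
import HarnessLib

/-!
# Route `SignedLowerHalves` (K3), child crux L `SmallImageLowerHalfBothSigns` (item stmt-BirchSwinnertonDyer-23599),
# line `birth_acns` v14, stub `stub_lambdaLowerThree_ns` (= retired item 23118 `SmallImageLambdaLowerAtThree`, VERBATIM):
# the λ-DOOR — the stub's per-datum conclusion is EXACTLY the λ-inequality `λ(L_p^ε) ≤ λ(ξ^ε)` — and its two preprint loci
# (route-independent part: no Theses import; the by-name readings are in `…LambdaLowerThreeNs.lean`)

Cell `bsd-ssimc`, width seat `bsd-line-slh-p3-w3` gen 0 (helper file `--supports stmt-BirchSwinnertonDyer-23599`;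
CALIBRATION / SUPPORT ONLY: the stub is NOT closed, no stub of the line of record is touched). HONEST FRAMING: the
stub — the `p`-inverted λ-part of the Eisenstein half of Kobayashi's signed main conjecture at `p = 3` on the
small-image (`¬ Surj`), non-CM, `a_3 = 0`, X7 (non-semistable) pairs, BOTH signs — is conjecture-grade (no engine in
print at non-square-free conductor; the image binder is idle in every known engine). Every theorem below is either
pure algebra or CONDITIONAL on DISPLAYED binders: published named facts (`h12`, `h41`) or the two unrefereed binders
of the tree (`FouquetWan2021_thm51_via_kobayashi74_OPEN`, `BurungaleSkinnerTianWan2024_thm13_twist_OPEN`).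
THEOREMS ONLY; no definition, no named fact, no `sorry`; BSD / child L / the stub NOT proved.

## What is proved

* §1 (pure `Λ = ℤ_p⟦T⟧`-algebra, `lam` = Weierstrass degree of `X1.MuLambda`): a RATIONAL
  divisibility `L ∣ p^t · ξ` forces `lam L ≤ lam ξ`; conversely, GIVEN Kato's rational divisibility `ξ ∣ p^n · L`, the
  inequality `lam L ≤ lam ξ` forces `L ∣ p^t · ξ` for some `t` (`exists_dvd_C_pow_mul_iff_lam_le_of_dvd_C_pow_mul`):
  the λ-analogue of the tree's μ-split `MuSplit.dvd_iff_exists_dvd_C_pow_mul_and_mu_le`.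
* §2 (the period ratio eliminated): for ANY non-zero rational `ϖ`, the `p`-inverted shape
  `ι(p^m · g) = ϖ · ι(L · h)` (some `h`, `m`) ⟺ `L ∣ p^t · g` (some `t`) — `ϖ = u · p^{a−b}` with `u ∈ ℤ_p^×`.
* §3 (per datum, the λ-DOOR): for a dual datum `D` with Kato's rational display `p^n · L ∈ char X` and `L ≠ 0`,
  `ϖ ≠ 0`: the stub's conclusion at `D` ⟺ `lam L ≤ lam ξ` for every (equivalently some) generator `ξ` of `char X`
  (`lambdaShape_iff_forall_lam_le`, `lambdaShape_iff_exists_lam_le`); Kato's display in the `C (p^n)` spelling from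
  Kobayashi Thm. 1.2 / 4.1 BY NAME, image-free (`exists_C_pow_mul_mem_charIdeal`).
* §4 (loci, modulo the tree's two PRE binders, image-free): the stub's conclusion at a pair with a non-split
  `ρ̄`-ramified multiplicative prime `ℓ ≠ p` (Fouquet–Wan Thm 5.1 ∘ Kobayashi Thm 7.4), and at a pair which is a
  prime-to-`pN` quadratic twist of a semistable curve by an ordinary-primes discriminant (BSTW Thm 1.3 twist clause).

References: [Kobayashi2003] Thm. 1.2, Thm. 4.1 (p. 8), Thm. 7.4 (p. 13), Conjecture (p. 2); [GreenbergVatsal2000] p. 4,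
(1)–(2); [Washington1997] §7.1, §13.2; [Pollack2003] Thm. 5.6, Prop. 6.18; [FouquetWan2021] Thm. 5.1 (PRE);
[BurungaleSkinnerTianWan2024] Thm. 1.3 (PRE).
-/

set_option autoImplicit false
-- D-0017: single-problem summit, the namespace repeats the problem name by design.
set_option linter.dupNamespace false

noncomputable section

open scoped Classical MatrixGroups ModularForm

open CongruenceSubgroup PowerSeries WeierstrassCurve Field Literature.NumberTheory.EllipticCurves
  Literature.NumberTheory.EllipticCurves.ModularForms
  Literature.NumberTheory.EllipticCurves.Rank1Residual
  Literature.NumberTheory.EllipticCurves.Kobayashi2003 ZpExtension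
  Literature.NumberTheory.EllipticCurves.Rank1Residual.Typed
  Summit.BirchSwinnertonDyer.Rank1Residual.X1.MuLambda
  Summit.BirchSwinnertonDyer.Rank1Residual.Supersingular

namespace Summit.BirchSwinnertonDyer.BirchSwinnertonDyer.Theorems.SmallImageLambdaLowerThreeNsDoor

/-! ## §1. Algebra in `Λ = ℤ_p⟦T⟧`: the λ-split of a rational divisibility -/

section Algebra

variable {p : ℕ} [Fact p.Prime]

/-- **Kato's direction of `λ` is free**: a rational divisibility `L ∣ p^t · ξ` with `ξ ≠ 0` gives `lam L ≤ lam ξ`.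
[cite: GreenbergVatsal2000, p. 4, (1)–(2)] -/
theorem lam_le_lam_of_dvd_C_pow_mul {L ξ : IwasawaAlgebra p} (hξ : ξ ≠ 0) {t : ℕ}
    (h : L ∣ C ((p : ℤ_[p]) ^ t) * ξ) : lam L ≤ lam ξ := by
  obtain ⟨w, hw⟩ := h
  have hprod : C ((p : ℤ_[p]) ^ t) * ξ ≠ 0 := mul_ne_zero (C_pow_ne_zero t) hξ
  have hL : L ≠ 0 := by rintro rfl; exact hprod (by rw [hw, zero_mul])
  have hw0 : w ≠ 0 := by rintro rfl; exact hprod (by rw [hw, mul_zero])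
  have := lam_le_lam_mul hL hw0
  rwa [← hw, Summit.BirchSwinnertonDyer.Rank1Residual.X1.ParitySqueeze.lam_C_pow_mul t hξ] at this

/-- **The λ-split (Eisenstein direction)**: GIVEN Kato's rational divisibility `ξ ∣ p^n · L` (`L ≠ 0`), the
λ-inequality `lam L ≤ lam ξ` forces the RATIONAL Eisenstein divisibility `L ∣ p^t · ξ` for some `t`
(`p^n L = ξ w` with `lam w = 0`, so `w = p^{μ(w)} · unit`). The λ-analogue of the μ-split
`MuSplit.dvd_iff_exists_dvd_C_pow_mul_and_mu_le`. [cite: GreenbergVatsal2000, p. 4 (after Thm. (1.2))] [cite: Washington1997, §7.1] -/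
theorem exists_dvd_C_pow_mul_of_lam_le_of_dvd_C_pow_mul {L ξ : IwasawaAlgebra p} (hL : L ≠ 0) {n : ℕ}
    (hKato : ξ ∣ C ((p : ℤ_[p]) ^ n) * L) (hle : lam L ≤ lam ξ) :
    ∃ t : ℕ, L ∣ C ((p : ℤ_[p]) ^ t) * ξ := by
  obtain ⟨w, hw⟩ := hKato
  have hprod : C ((p : ℤ_[p]) ^ n) * L ≠ 0 := mul_ne_zero (C_pow_ne_zero n) hL
  have hξ : ξ ≠ 0 := by rintro rfl; exact hprod (by rw [hw, zero_mul])
  have hw0 : w ≠ 0 := by rintro rfl; exact hprod (by rw [hw, mul_zero])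
  have hlamw : lam w = 0 := by
    have h1 : lam (C ((p : ℤ_[p]) ^ n) * L) = lam ξ + lam w := by rw [hw, lam_mul hξ hw0]
    rw [Summit.BirchSwinnertonDyer.Rank1Residual.X1.ParitySqueeze.lam_C_pow_mul n hL] at h1
    omega
  -- `lam w = 0`: the `p`-free part of `w` is a unit (`μ(pfree w) = 0 = λ(pfree w)`)
  obtain ⟨u, hu⟩ : IsUnit (pfree w) := by
    obtain ⟨hmu, hpf⟩ := mu_eq_and_pfree_eq (red_pfree_ne_zero hw0)
      (show pfree w = C ((p : ℤ_[p]) ^ 0) * pfree w by rw [pow_zero, map_one, one_mul])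
    refine (isUnit_iff_mu_eq_zero_and_lam_eq_zero _).mpr ⟨pfree_ne_zero hw0, hmu, ?_⟩
    rw [lam, hpf, ← hlamw, lam]
  -- `w = p^c · v` with `v` a unit, so `p^c ξ = L · (p^n v⁻¹)`
  obtain ⟨c, v, hwcv⟩ : ∃ (c : ℕ) (v : (IwasawaAlgebra p)ˣ), w = C ((p : ℤ_[p]) ^ c) * (v : IwasawaAlgebra p) :=
    ⟨mu w, u, by rw [hu]; exact eq_C_pow_mu_mul_pfree w⟩
  subst hwcv
  refine ⟨c, C ((p : ℤ_[p]) ^ n) * ((v⁻¹ : (IwasawaAlgebra p)ˣ) : IwasawaAlgebra p), ?_⟩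
  calc C ((p : ℤ_[p]) ^ c) * ξ
      = C ((p : ℤ_[p]) ^ c) * ξ * ((v : IwasawaAlgebra p) * ((v⁻¹ : (IwasawaAlgebra p)ˣ) : IwasawaAlgebra p)) := by
        rw [Units.mul_inv, mul_one]
    _ = (ξ * (C ((p : ℤ_[p]) ^ c) * (v : IwasawaAlgebra p))) * ((v⁻¹ : (IwasawaAlgebra p)ˣ) : IwasawaAlgebra p) := by
        ring
    _ = L * (C ((p : ℤ_[p]) ^ n) * ((v⁻¹ : (IwasawaAlgebra p)ˣ) : IwasawaAlgebra p)) := by rw [← hw]; ring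

/-- **The λ-split, two-sided**: given Kato's rational divisibility `ξ ∣ p^n · L` (`L, ξ ≠ 0`), the rational Eisenstein
divisibility `∃ t, L ∣ p^t · ξ` is EQUIVALENT to `lam L ≤ lam ξ` (and then `lam L = lam ξ`, the reverse inequality
being Kato's). [cite: GreenbergVatsal2000, p. 4 (after Thm. (1.2))] -/
theorem exists_dvd_C_pow_mul_iff_lam_le_of_dvd_C_pow_mul {L ξ : IwasawaAlgebra p} (hL : L ≠ 0) (hξ : ξ ≠ 0)
    {n : ℕ} (hKato : ξ ∣ C ((p : ℤ_[p]) ^ n) * L) :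
    (∃ t : ℕ, L ∣ C ((p : ℤ_[p]) ^ t) * ξ) ↔ lam L ≤ lam ξ :=
  ⟨fun ⟨_, ht⟩ ↦ lam_le_lam_of_dvd_C_pow_mul hξ ht,
    fun hle ↦ exists_dvd_C_pow_mul_of_lam_le_of_dvd_C_pow_mul hL hKato hle⟩

/-- Under Kato's rational divisibility `ξ ∣ p^n · L` (`L ≠ 0`), `lam ξ ≤ lam L`; so the λ-inequality of the
Eisenstein direction is the λ-EQUALITY. [cite: GreenbergVatsal2000, p. 4] -/
theorem lam_le_iff_lam_eq_of_dvd_C_pow_mul {L ξ : IwasawaAlgebra p} (hL : L ≠ 0) {n : ℕ}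
    (hKato : ξ ∣ C ((p : ℤ_[p]) ^ n) * L) : lam L ≤ lam ξ ↔ lam L = lam ξ := by
  have := lam_le_lam_of_dvd_C_pow_mul hL hKato
  omega

/-- Generators of the same principal ideal of `Λ` have the same `lam`. [folklore] -/
theorem lam_eq_of_span_eq {g g' : IwasawaAlgebra p} (hg : g ≠ 0)
    (h : Ideal.span ({g} : Set (IwasawaAlgebra p)) = Ideal.span {g'}) : lam g = lam g' := by
  obtain ⟨u, hu⟩ := Ideal.span_singleton_eq_span_singleton.mp h
  have hu' := (isUnit_iff_mu_eq_zero_and_lam_eq_zero (u : IwasawaAlgebra p)).mp u.isUnit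
  rw [← hu, lam_mul hg hu'.1, hu'.2.2, add_zero]

end Algebra

/-! ## §2. The period ratio eliminated: `ι(p^m g) = ϖ · ι(L h)` ⟺ `L ∣ p^t g` for any `ϖ ∈ ℚ^×` -/

section Period

variable {p : ℕ} [Fact p.Prime]

/-- `ι(C c) = C c` for a constant `c ∈ ℤ_p` (`ι = iwasawaToPowerSeries`, coefficientwise `ℤ_p ↪ ℚ_p`). [folklore] -/
theorem iota_C (c : ℤ_[p]) : iwasawaToPowerSeries p (C c) = C ((c : ℤ_[p]) : ℚ_[p]) := by
  rw [iwasawaToPowerSeries, PowerSeries.map_C]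
  rfl

/-- **A non-zero rational is `u · p^{a−b}` in `ℚ_p` with `u ∈ ℤ_p^×`**: `u · p^a = ϖ · p^b` for some natural `a, b`.
[folklore] -/
theorem exists_units_mul_pow_eq_mul_pow {ϖ : ℚ} (hϖ0 : ϖ ≠ 0) :
    ∃ (u : ℤ_[p]ˣ) (a b : ℕ), ((u : ℤ_[p]) : ℚ_[p]) * (p : ℚ_[p]) ^ a = (ϖ : ℚ_[p]) * (p : ℚ_[p]) ^ b := by
  have hpP : p.Prime := Fact.out
  have hp0 : (p : ℚ) ≠ 0 := by exact_mod_cast hpP.ne_zero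
  set v : ℤ := padicValRat p ϖ with hv
  set q : ℚ := ϖ * (p : ℚ) ^ (-v) with hq
  have hzp : (p : ℚ) ^ (-v) ≠ 0 := zpow_ne_zero _ hp0
  have hq0 : q ≠ 0 := mul_ne_zero hϖ0 hzp
  have hvq : padicValRat p q = 0 := by
    rw [hq, padicValRat.mul hϖ0 hzp, padicValRat.zpow, padicValRat.self hpP.one_lt]
    ring
  obtain ⟨u, hu⟩ := exists_units_coe_eq_ratCast hq0 hvq
  refine ⟨u, v.toNat, (-v).toNat, ?_⟩
  have hpQ : (p : ℚ_[p]) ≠ 0 := by exact_mod_cast hpP.ne_zero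
  have hsub : ((v.toNat : ℕ) : ℤ) - (((-v).toNat : ℕ) : ℤ) = v := Int.toNat_sub_toNat_neg v
  have key : (p : ℚ_[p]) ^ (-v) * (p : ℚ_[p]) ^ ((v.toNat : ℕ) : ℤ) = (p : ℚ_[p]) ^ (((-v).toNat : ℕ) : ℤ) := by
    rw [← zpow_add₀ hpQ]
    congr 1
    omega
  rw [hu, hq]
  push_cast
  rw [← zpow_natCast, ← zpow_natCast, mul_assoc, key]

/-- **The `p`-inverted shape gives a rational divisibility**: `ι(p^m · g) = ϖ · ι(L · h)` with `ϖ ≠ 0` ⟹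
`L ∣ p^t · g` for some `t`. [cite: GreenbergVatsal2000, p. 4] -/
theorem exists_dvd_C_pow_mul_of_pInverted {ϖ : ℚ} (hϖ0 : ϖ ≠ 0) {L g h : IwasawaAlgebra p} {m : ℕ}
    (hι : iwasawaToPowerSeries p (C ((p : ℤ_[p]) ^ m) * g) =
      PowerSeries.C (ϖ : ℚ_[p]) * iwasawaToPowerSeries p (L * h)) :
    ∃ t : ℕ, L ∣ C ((p : ℤ_[p]) ^ t) * g := by
  obtain ⟨u, a, b, hu⟩ := exists_units_mul_pow_eq_mul_pow (p := p) hϖ0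
  refine ⟨m + b, C (u : ℤ_[p]) * C ((p : ℤ_[p]) ^ a) * h, ?_⟩
  apply iwasawaToPowerSeries_injective p
  have h1 := congrArg (fun x ↦ PowerSeries.C ((p : ℚ_[p]) ^ b) * x) hι
  simp only [map_mul, iota_C, pow_add] at h1 ⊢
  push_cast at h1 ⊢
  have h2 : PowerSeries.C (((u : ℤ_[p]) : ℚ_[p])) * PowerSeries.C ((p : ℚ_[p]) ^ a) =
      PowerSeries.C (ϖ : ℚ_[p]) * PowerSeries.C ((p : ℚ_[p]) ^ b) := by
    rw [← map_mul, ← map_mul, hu]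
  linear_combination h1 - (iwasawaToPowerSeries p L * iwasawaToPowerSeries p h) * h2

/-- **A rational divisibility gives the `p`-inverted shape**: `L ∣ p^t · g` and `ϖ ≠ 0` ⟹
`ι(p^m · g) = ϖ · ι(L · h)` for some `h ∈ Λ`, `m : ℕ`. [cite: GreenbergVatsal2000, p. 4] -/
theorem exists_pInverted_of_dvd_C_pow_mul {ϖ : ℚ} (hϖ0 : ϖ ≠ 0) {L g : IwasawaAlgebra p} {t : ℕ}
    (hdvd : L ∣ C ((p : ℤ_[p]) ^ t) * g) :
    ∃ (h : IwasawaAlgebra p) (m : ℕ), iwasawaToPowerSeries p (C ((p : ℤ_[p]) ^ m) * g) =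
      PowerSeries.C (ϖ : ℚ_[p]) * iwasawaToPowerSeries p (L * h) := by
  obtain ⟨u, a, b, hu⟩ := exists_units_mul_pow_eq_mul_pow (p := p) hϖ0
  obtain ⟨k, hk⟩ := hdvd
  refine ⟨C ((p : ℤ_[p]) ^ b) * C (((u⁻¹ : ℤ_[p]ˣ) : ℤ_[p])) * k, t + a, ?_⟩
  have h1 : C ((p : ℤ_[p]) ^ (t + a)) * g = C ((p : ℤ_[p]) ^ a) * (L * k) := by
    rw [← hk, pow_add, map_mul]; ring
  have hUU : PowerSeries.C (((u : ℤ_[p]) : ℚ_[p])) * PowerSeries.C ((((u⁻¹ : ℤ_[p]ˣ) : ℤ_[p])) : ℚ_[p]) =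
      (1 : PowerSeries ℚ_[p]) := by
    rw [← map_mul, ← PadicInt.coe_mul, Units.mul_inv, PadicInt.coe_one, map_one]
  have h2 : PowerSeries.C (((u : ℤ_[p]) : ℚ_[p])) * PowerSeries.C ((p : ℚ_[p]) ^ a) =
      PowerSeries.C (ϖ : ℚ_[p]) * PowerSeries.C ((p : ℚ_[p]) ^ b) := by
    rw [← map_mul, ← map_mul, hu]
  rw [h1]
  simp only [map_mul, iota_C]
  push_cast
  linear_combination (iwasawaToPowerSeries p L * iwasawaToPowerSeries p k *
      PowerSeries.C ((((u⁻¹ : ℤ_[p]ˣ) : ℤ_[p])) : ℚ_[p])) * h2 -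
    (iwasawaToPowerSeries p L * iwasawaToPowerSeries p k * PowerSeries.C ((p : ℚ_[p]) ^ a)) * hUU

/-- **§2 summary**: for `ϖ ∈ ℚ^×`, the `p`-inverted shape `∃ h m, ι(p^m g) = ϖ · ι(L h)` ⟺ `∃ t, L ∣ p^t g`.
[cite: GreenbergVatsal2000, p. 4] -/
theorem pInverted_iff_exists_dvd_C_pow_mul {ϖ : ℚ} (hϖ0 : ϖ ≠ 0) (L g : IwasawaAlgebra p) :
    (∃ (h : IwasawaAlgebra p) (m : ℕ), iwasawaToPowerSeries p (C ((p : ℤ_[p]) ^ m) * g) =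
        PowerSeries.C (ϖ : ℚ_[p]) * iwasawaToPowerSeries p (L * h)) ↔
      ∃ t : ℕ, L ∣ C ((p : ℤ_[p]) ^ t) * g :=
  ⟨fun ⟨_, _, hι⟩ ↦ exists_dvd_C_pow_mul_of_pInverted hϖ0 hι, fun ⟨_, ht⟩ ↦ exists_pInverted_of_dvd_C_pow_mul hϖ0 ht⟩

end Period

/-! ## §3. The λ-DOOR at one dual datum: the stub's conclusion ⟺ `lam L ≤ lam ξ` -/

section Door

variable {p : ℕ} [Fact p.Prime] {W : WeierstrassCurve ℚ} {κ : ZpExtension ℚ p} {γ : absoluteGaloisGroup ℚ} {ε : ℤˣ}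

/-- A generator of `char X^ε(E/ℚ_∞)` is non-zero: the tree's characteristic ideal of any module over the domain `Λ`
is never `⊥` (`Module.charIdeal_ne_bot`). [folklore] -/
theorem ne_zero_of_charIdeal_eq_span (D : SignedSelmerDualData W κ γ ε) {ξ : IwasawaAlgebra p}
    (hξ : D.charIdeal = Ideal.span {ξ}) : ξ ≠ 0 := by
  rintro rfl
  apply Module.charIdeal_ne_bot (IwasawaAlgebra p) D.X
  have h : Module.charIdeal (IwasawaAlgebra p) D.X = Ideal.span {(0 : IwasawaAlgebra p)} := hξ
  rw [h, Ideal.span_singleton_eq_bot]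

/-- **The λ-DOOR (per datum).** Let `D` be a Pontryagin-dual datum of `Sel^ε(E/ℚ_∞)`, `L ∈ Λ` non-zero with Kato's
RATIONAL display `p^n · L ∈ char X^ε` for some `n` (Kobayashi Thm. 4.1, first display — no image hypothesis), and
`ϖ ∈ ℚ^×`. Then the `p`-inverted λ-shape «`char X^ε = (g)` and `ι(p^m · g) = ϖ · ι(L · h)` for some `g, h, m`» holds
IFF `lam L ≤ lam ξ` for every generator `ξ` of `char X^ε`. (`char X^ε` is principal and `≠ ⊥` in the tree; §1–§2.)
[cite: Kobayashi2003, Thm. 4.1 (p. 8) and Conjecture (p. 2)] [cite: GreenbergVatsal2000, p. 4 (after Thm. (1.2))] -/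
theorem lambdaShape_iff_forall_lam_le (D : SignedSelmerDualData W κ γ ε) {ϖ : ℚ} (hϖ0 : ϖ ≠ 0)
    {L : IwasawaAlgebra p} (hL : L ≠ 0) (hKato : ∃ n : ℕ, C ((p : ℤ_[p]) ^ n) * L ∈ D.charIdeal) :
    (∃ (g h : IwasawaAlgebra p) (m : ℕ), D.charIdeal = Ideal.span {g} ∧
        iwasawaToPowerSeries p (C ((p : ℤ_[p]) ^ m) * g) =
          PowerSeries.C (ϖ : ℚ_[p]) * iwasawaToPowerSeries p (L * h)) ↔
      ∀ ξ : IwasawaAlgebra p, D.charIdeal = Ideal.span {ξ} → lam L ≤ lam ξ := by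
  constructor
  · rintro ⟨g, h, m, hg, hι⟩ ξ hξ
    have hg0 : g ≠ 0 := ne_zero_of_charIdeal_eq_span D hg
    obtain ⟨t, ht⟩ := exists_dvd_C_pow_mul_of_pInverted hϖ0 hι
    rw [← lam_eq_of_span_eq hg0 (hg.symm.trans hξ)]
    exact lam_le_lam_of_dvd_C_pow_mul hg0 ht
  · intro hle
    obtain ⟨ξ, hξ⟩ := (charIdeal_isPrincipal_holds p D.X).principal
    have hξ' : D.charIdeal = Ideal.span {ξ} := hξ
    obtain ⟨n, hn⟩ := hKato
    rw [hξ', Ideal.mem_span_singleton] at hn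
    obtain ⟨t, ht⟩ := exists_dvd_C_pow_mul_of_lam_le_of_dvd_C_pow_mul hL hn (hle ξ hξ')
    obtain ⟨h, m, hι⟩ := exists_pInverted_of_dvd_C_pow_mul hϖ0 ht
    exact ⟨ξ, h, m, hξ', hι⟩

/-- The λ-door, existential form: under the same hypotheses the `p`-inverted λ-shape holds IFF SOME generator `ξ` of
`char X^ε` has `lam L ≤ lam ξ`. [cite: Kobayashi2003, Thm. 4.1 (p. 8)] [cite: GreenbergVatsal2000, p. 4] -/
theorem lambdaShape_iff_exists_lam_le (D : SignedSelmerDualData W κ γ ε) {ϖ : ℚ} (hϖ0 : ϖ ≠ 0)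
    {L : IwasawaAlgebra p} (hL : L ≠ 0) (hKato : ∃ n : ℕ, C ((p : ℤ_[p]) ^ n) * L ∈ D.charIdeal) :
    (∃ (g h : IwasawaAlgebra p) (m : ℕ), D.charIdeal = Ideal.span {g} ∧
        iwasawaToPowerSeries p (C ((p : ℤ_[p]) ^ m) * g) =
          PowerSeries.C (ϖ : ℚ_[p]) * iwasawaToPowerSeries p (L * h)) ↔
      ∃ ξ : IwasawaAlgebra p, D.charIdeal = Ideal.span {ξ} ∧ lam L ≤ lam ξ := by
  rw [lambdaShape_iff_forall_lam_le D hϖ0 hL hKato]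
  constructor
  · intro h
    obtain ⟨ξ, hξ⟩ := (charIdeal_isPrincipal_holds p D.X).principal
    exact ⟨ξ, hξ, h ξ hξ⟩
  · rintro ⟨ξ, hξ, hle⟩ ξ' hξ'
    rwa [← lam_eq_of_span_eq (ne_zero_of_charIdeal_eq_span D hξ) (hξ.symm.trans hξ')]

/-- **Kato's rational display in the `C (p^n)` spelling**: granted Kobayashi Thm. 1.2 (`h12`) and Thm. 4.1 (`h41`),
at an odd good prime with `a_p = 0`, for the newform `f`, a cyclotomic frame and a signed `p`-adic `L`-function `L` of
sign `ε`: `C (p^n) · L ∈ char X^ε` for some `n` — NO image hypothesis. [cite: Kobayashi2003, Thm. 1.2 and Thm. 4.1 (p. 8)] -/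
theorem exists_C_pow_mul_mem_charIdeal [W.IsElliptic] [W.IsGloballyMinimal]
    (h12 : Kobayashi2003.thm12_signedSelmerDual_finite_torsion)
    (h41 : Kobayashi2003.thm41_signedCharIdeal_divisibility) (hp : p ≠ 2)
    (hgood : W.HasGoodReductionAtPrime p) (hap : W.frobeniusTrace p = 0) {N : ℕ} [NeZero N]
    {f : CuspForm (Gamma0 N) 2} (hf : IsNewformOf W f) (hκ : κ.IsCyclotomic) (hγ : κ.IsTopGenerator γ)
    (hγ' : IsCyclotomicVariable p γ) {L : IwasawaAlgebra p} (hL : IsSignedPAdicLFunction f p ε L)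
    (D : SignedSelmerDualData W κ γ ε) :
    ∃ n : ℕ, C ((p : ℤ_[p]) ^ n) * L ∈ D.charIdeal := by
  obtain ⟨n, hn⟩ := (h41.of_thm12 h12 hp hgood hap hf hκ hγ hγ' hL D).1
  refine ⟨n, ?_⟩
  have hpn : (p : IwasawaAlgebra p) ^ n = C ((p : ℤ_[p]) ^ n) := by rw [C_pow_eq, map_natCast]
  rwa [hpn] at hn

end Door

/-! ## §4. The two preprint loci (image-free binders of the tree) -/

section Loci

variable (W : WeierstrassCurve ℚ) [W.IsElliptic] [W.IsGloballyMinimal] (p : ℕ) [Fact p.Prime]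

/-- **The Fouquet–Wan locus.** GRANTED the tree's OPEN binder «FW Thm 5.1 (PRE) ∘ Kobayashi Thm 7.4 (PUB)»
(`hFW`): at an X7 pair with `p ≠ 2`, `a_p = 0` and a NON-SPLIT multiplicative prime `ℓ ≠ p` with `p ∤ ord_ℓ Δ_min`
(`ρ̄` ramified at `ℓ`), the stub's `p`-inverted λ-shape holds for EVERY sign (indeed the integral half, `m = 0`; no image
binder is used). CONDITIONAL on an unrefereed preprint; closes nothing. [claim: FouquetWan2021, status: under-review]
[cite: Kobayashi2003, Thm. 7.4 (p. 13) and Conjecture (p. 2)] -/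
theorem lambdaShape_of_thm51_OPEN (hFW : FouquetWan2021_thm51_via_kobayashi74_OPEN)
    (hp : p ≠ 2) (hX : ClassX7 W p) (hap : W.frobeniusTrace p = 0)
    (hloc : ∃ (ℓ : ℕ) (_ : Fact ℓ.Prime), ℓ ≠ p ∧ W.HasMultiplicativeReductionAtPrime ℓ ∧
        ¬ W.HasSplitMultiplicativeReductionAtPrime ℓ ∧ ¬ p ∣ padicValInt ℓ W.minimalDiscriminantInt)
    (ε : ℤˣ) (κ : ZpExtension ℚ p) (γ : absoluteGaloisGroup ℚ) (hκ : κ.IsCyclotomic) (hγ : κ.IsTopGenerator γ)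
    (hγ' : IsCyclotomicVariable p γ) [NeZero (W.conductorNorm ℤ)] (f : CuspForm (Gamma0 (W.conductorNorm ℤ)) 2)
    (hf : IsNewformOf W f) (ϖ : ℚ) (hϖ : (ϖ : ℝ) * W.realPeriodRat = plusPeriod f)
    (Lplus Lminus : IwasawaAlgebra p) (hPP : IsPollackPair f p Lplus Lminus) (D : SignedSelmerDualData W κ γ ε) :
    ∃ (g h : IwasawaAlgebra p) (m : ℕ), D.charIdeal = Ideal.span {g} ∧
      iwasawaToPowerSeries p (PowerSeries.C ((p : ℤ_[p]) ^ m) * g) =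
        PowerSeries.C (ϖ : ℚ_[p]) * iwasawaToPowerSeries p (kobayashiL ε Lplus Lminus * h) := by
  obtain ⟨g, h', hg, hι⟩ := kobayashiLowerDivisibility_of_mainConjecture
    (hFW W p hp hX.1.1 hap (ClassX7.irr W p hp hX) hloc ε) κ γ hκ hγ hγ' f hf ϖ hϖ Lplus Lminus hPP D
  exact ⟨g, h', 0, hg, by rw [pow_zero, map_one, one_mul]; exact hι⟩

/-- **The BSTW twist locus.** GRANTED the tree's OPEN binder «BSTW Thm. 1.3 with its twist clause» (`hBSTW`, PRE):
if `W` is (a globally minimal model of) the quadratic twist of a SEMISTABLE `W₀`, good supersingular at the odd prime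
`p` (`a_3(W₀) = 0` if `p = 3`), by a quadratic field `K` with `d_K` coprime to `N_{W₀} · p` all of whose primes are
good ordinary for `W₀`, then the stub's `p`-inverted λ-shape holds at `W` for EVERY sign (`m = 0`; no image binder).
CONDITIONAL on an unrefereed preprint; closes nothing. [claim: BurungaleSkinnerTianWan2024, status: under-review]
[cite: Kobayashi2003, Conjecture (p. 2)] -/
theorem lambdaShape_of_BSTW13_twist_OPEN (hBSTW : BurungaleSkinnerTianWan2024_thm13_twist_OPEN)
    {W₀ : WeierstrassCurve ℚ} [W₀.IsElliptic] [W₀.IsGloballyMinimal] (hp : p ≠ 2) (hsst : Semistable W₀)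
    (hss : GoodSS W₀ p) (h4 : p = 3 → W₀.frobeniusTrace 3 = 0)
    (K : Type) [Field K] [NumberField K] (hK : Module.finrank ℚ K = 2)
    (hcop : IsCoprime (NumberField.discr K) ((W₀.conductorNorm ℤ * p : ℕ) : ℤ))
    (hord : ∀ (ℓ : ℕ) [Fact ℓ.Prime], (ℓ : ℤ) ∣ NumberField.discr K → GoodOrd W₀ ℓ)
    (hWd : ∃ C : VariableChange ℚ, C • W₀.quadraticTwist (NumberField.discr K : ℚ) = W)
    (ε : ℤˣ) (κ : ZpExtension ℚ p) (γ : absoluteGaloisGroup ℚ) (hκ : κ.IsCyclotomic) (hγ : κ.IsTopGenerator γ)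
    (hγ' : IsCyclotomicVariable p γ) [NeZero (W.conductorNorm ℤ)] (f : CuspForm (Gamma0 (W.conductorNorm ℤ)) 2)
    (hf : IsNewformOf W f) (ϖ : ℚ) (hϖ : (ϖ : ℝ) * W.realPeriodRat = plusPeriod f)
    (Lplus Lminus : IwasawaAlgebra p) (hPP : IsPollackPair f p Lplus Lminus) (D : SignedSelmerDualData W κ γ ε) :
    ∃ (g h : IwasawaAlgebra p) (m : ℕ), D.charIdeal = Ideal.span {g} ∧
      iwasawaToPowerSeries p (PowerSeries.C ((p : ℤ_[p]) ^ m) * g) =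
        PowerSeries.C (ϖ : ℚ_[p]) * iwasawaToPowerSeries p (kobayashiL ε Lplus Lminus * h) := by
  obtain ⟨g, h', hg, hι⟩ := kobayashiLowerDivisibility_of_BSTW13_twist_OPEN W₀ p hBSTW hp hsst hss h4 K hK hcop hord
    W hWd ε κ γ hκ hγ hγ' f hf ϖ hϖ Lplus Lminus hPP D
  exact ⟨g, h', 0, hg, by rw [pow_zero, map_one, one_mul]; exact hι⟩

end Loci

end Summit.BirchSwinnertonDyer.BirchSwinnertonDyer.Theorems.SmallImageLambdaLowerThreeNsDoor

end
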